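import Mathlib.Analysis.SpecialFunctions.Pow.Real
import HarnessLib

/-!
# Route `UnitScaleTilt`, crux K1 child «MinimiserStabilityRegPr» (stmt-QuantumFields-19200), stub `stub_existenceMinimalOrbit` (EX), route (α) — **«NUMERICS-CENSUS» KERNEL CERTIFICATE**:
# the L-only numeric windows of the EX display S13ᴰ ✓p682315 (`hWQ hWe hWε hMe hw137 hq47 hR6 hrε2 hrα hr4 hr16 hMdoor`) together with RC-OF-ROWS ✓p682625 (`hbH hεC hdomC hselfC hcontrC`)
# are JOINTLY INHABITED — for every block size and all positive N06 letters — by EXPLICIT constants (EX namer WORD (15) 2026-08-29T00:39:25Z; memo `NUMERICS-CENSUS-px14g3.md` ec96f60532af6d0e)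

Cell `ym3-torus`, width seat `ym3-torus-px14` (gen 3).  THEOREMS ONLY (0 `def`, 0 `sorry`); `--supports stmt-QuantumFields-19200 --as helper`; count-neutral.  YM₃ on T³ is a ladder rung (R3),
NOT the Clay problem; nothing here claims the stub, the crux, d = 4 or the mass gap.  PURE REAL ARITHMETIC: no lattice object is mentioned.

THE PRINT.  [Balaban1985Variational] Thm 1 p. 279 «there exist positive constants a₀, a₁, B₃ depending on d and L only»; Prop. 6 (118)–(121) p. 295 («for ε₄ ≤ a₄ and ε₁ satisfying 2B₀C₁B₃ε₁ ≤ ε₄»);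
Prop. 3 p. 289 («ε₃ sufficiently small (e.g. …)»); (77) p. 290; Prop. 4 (98) p. 293 («if … ≤ a₃»).  Every smallness condition of Sects. C–G is an UPPER bound on the regularity
threshold in terms of the O(1) letters `B₀, C₂, C₄, …`; this file checks, for the display's LETTERED windows, that they are simultaneously satisfiable.

WHAT IS PROVED (sorry-free, no definition).
* §1 row lemmas (abstract reals; each takes only the facts it needs): `C₂_le` (`α ≤ ef∕(2700L) ⇒ C₂ ≤ 720∕ef`), `row_hWe`, `row_hw137`, `row_hq47`, `row_hR6`, `row_hselfC`, `row_hcontrC`,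
  `row_hdomC`, `row_hMdoor` (monotonicity of the (136)-door constant in `α`).
* §2 ★★ `numericWindows_inhabited_family` — for letters `B₀ C₄ bH : ℕ → ℝ` positive (`B₀ ≤ bH`; `C₄` GIVEN here) and N06 letters `cC c137 kTJ k349 c137π k139π ≥ 0` (the display's `hB₀ hC₄ hk` + ✓p682625's
  `hbH`), THERE EXIST `ef α a₃ r ε′ εC M : ℕ → ℝ`, positive on `1 < L`, satisfying the SEVENTEEN rows `hWQ hWe hWε hMe hw137 hq47 hR6 hrε2 hrα hr4 hr16 hMdoor hεC hdomC hselfC hcontrC`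
  in the display's binder shapes VERBATIM (`∀ L : ℕ, 1 < L → …`).  Witness (memo §2): `ef := (356·10⁷·L³)⁻¹`, `a₃ := εC := ef∕(8000(bH+1))`, `r := min(a₃∕4, (16B₀C₄)⁻¹)`,
  `M :=` the door's LHS at `α₀ := ef∕(2700L)` with `C₂ ↦ 720∕ef`, `α := ½·min(min(α₀, ef∕M), min(r∕(2B₀), (13·10¹⁴L³)⁻¹))`, `ε′ := 2(r + 2B₀α)`.
* §1b row lemmas `contr_le` (`4bH·C₂·(εC + a₃) ≤ 18∕25`), `ell_le` (`ℓ ≤ 25∕7`), `row_hR16`, `row_hC4` (monotonicity of lit ✓`quadAnalytic_W80_composite`'s constant in `(α, C₂, ℓ)`) for the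
  PROP4-W80 door's numerals (✓p683940) — consumed by the sibling file `UnitScaleTiltProp7NumericWindowsInhabitedComposite.lean` (`numericWindows_inhabited_family_composite`: the same ∃ with
  `C₄` a WITNESS and `hR16 hC4` added, NINETEEN rows).
HONEST SCOPE.  Arithmetic only: it certifies that the displays' numeric rows do not contradict each other for ANY values of the N06∕W6 letters — it says nothing about those letters'
suppliers (N06∕W6 rows stay displayed).

References: T. Bałaban, CMP **102** (1985) 277–309 [Balaban1985Variational] (Thm 1 p.279, (77) p.290, Prop. 3 p.289, Prop. 4 (98) p.293, (118)–(121) p.295, (136)–(140) pp.298–299).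
-/

set_option autoImplicit false

noncomputable section

namespace Summit.QuantumFields.YangMills.Theorems.Prop7NumericWindowsInhabited

/-! ## §1 Row lemmas over abstract reals -/

/-- The chart constant `C₂ = 240(2ef + 2700Lα)∕ef²` is at most `720∕ef` once `2700·L·α ≤ ef`. [cite: Balaban1985Variational, Prop. 3 p.289] -/
theorem C₂_le {ef Lr α : ℝ} (hef : 0 < ef) (hα : 2700 * Lr * α ≤ ef) :
    40 * (2 * (3 * (2 * ef + 2700 * Lr * α))) / ef ^ 2 ≤ 720 / ef := by
  rw [div_le_div_iff₀ (by positivity) hef]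
  nlinarith [mul_pos hef hef]

/-- `C₂ ≥ 0`. [cite: Balaban1985Variational, Prop. 3 p.289] -/
theorem C₂_nonneg {ef Lr α : ℝ} (hef : 0 < ef) (hLr : 0 ≤ Lr) (hα0 : 0 ≤ α) :
    0 ≤ 40 * (2 * (3 * (2 * ef + 2700 * Lr * α))) / ef ^ 2 := by positivity

/-- Row `hWe` at `ef := (356·10⁷·L³)⁻¹`: `10⁹·L²·ef ≤ 1` for `L ≥ 1`. [cite: Balaban1985Variational, (77) p.290] -/
theorem row_hWe {Lr : ℝ} (hLr : 1 ≤ Lr) : 10 ^ 9 * Lr ^ 2 * (1 / (356 * 10 ^ 7 * Lr ^ 3)) ≤ 1 := by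
  have hL0 : 0 < Lr := by linarith
  rw [← mul_div_assoc, mul_one, div_le_one (by positivity)]
  nlinarith [pow_pos hL0 2, pow_pos hL0 3, mul_le_mul_of_nonneg_left hLr (pow_pos hL0 2).le]

/-- Row `hw137` at `ef := (356·10⁷·L³)⁻¹` for `α ≤ ef`: `10⁷·L³·(178·(α + ef)) ≤ 1`. [cite: Balaban1985Variational, (137) p.298] -/
theorem row_hw137 {Lr α : ℝ} (hLr : 0 < Lr) (hα : α ≤ 1 / (356 * 10 ^ 7 * Lr ^ 3)) :
    10 ^ 7 * Lr ^ 3 * (178 * (α + 1 / (356 * 10 ^ 7 * Lr ^ 3))) ≤ 1 := by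
  have h3 : 0 < Lr ^ 3 := pow_pos hLr 3
  have key : 10 ^ 7 * Lr ^ 3 * (178 * (2 * (1 / (356 * 10 ^ 7 * Lr ^ 3)))) = 1 := by
    field_simp; ring
  calc 10 ^ 7 * Lr ^ 3 * (178 * (α + 1 / (356 * 10 ^ 7 * Lr ^ 3)))
      ≤ 10 ^ 7 * Lr ^ 3 * (178 * (2 * (1 / (356 * 10 ^ 7 * Lr ^ 3)))) := by gcongr; linarith
    _ = 1 := key

/-- Row `hq47`: `9·C₂·B₀·ε′ < 1` from `C₂ ≤ 720∕ef`, `ε′ ≤ a₃ = ef∕(8000(bH+1))`, `B₀ ≤ bH`. [cite: Balaban1985Variational, (47) p.285, Prop. 3 p.289] -/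
theorem row_hq47 {ef C₂ B₀ bH ε' a₃ : ℝ} (hef : 0 < ef) (hB₀ : 0 < B₀) (hbH : B₀ ≤ bH) (hC₂ : C₂ ≤ 720 / ef)
    (hε'0 : 0 ≤ ε') (hε' : ε' ≤ a₃) (ha₃ : a₃ = ef / (8000 * (bH + 1))) : 9 * C₂ * B₀ * ε' < 1 := by
  have hbH1 : 0 < bH + 1 := by linarith
  calc 9 * C₂ * B₀ * ε' ≤ 9 * (720 / ef) * B₀ * a₃ := by gcongr
    _ = 6480 * B₀ / (8000 * (bH + 1)) := by rw [ha₃]; field_simp; ring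
    _ < 1 := by rw [div_lt_one (by positivity)]; nlinarith

/-- Row `hR6`: `6ε′ ≤ ef` from `ε′ ≤ a₃ = ef∕(8000(bH+1))`. [cite: Balaban1985Variational, Prop. 6 p.295] -/
theorem row_hR6 {ef bH ε' a₃ : ℝ} (hef : 0 < ef) (hbH : 0 < bH) (hε' : ε' ≤ a₃) (ha₃ : a₃ = ef / (8000 * (bH + 1))) : 6 * ε' ≤ ef := by
  have hbH1 : (1 : ℝ) ≤ bH + 1 := by linarith
  have h1 : a₃ ≤ ef / 6 := by
    rw [ha₃, div_le_div_iff₀ (by positivity) (by norm_num)]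
    nlinarith [mul_le_mul_of_nonneg_left hbH1 hef.le]
  linarith

/-- Row `hdomC` ((121)₁): `2(εC + a₃) ≤ ef∕2` at `εC = a₃ = ef∕(8000(bH+1))`. [cite: Balaban1985Variational, (121) p.295] -/
theorem row_hdomC {ef bH a₃ : ℝ} (hef : 0 < ef) (hbH : 0 < bH) (ha₃ : a₃ = ef / (8000 * (bH + 1))) : 2 * (a₃ + a₃) ≤ ef / 2 := by
  have hbH1 : (1 : ℝ) ≤ bH + 1 := by linarith
  have h1 : a₃ ≤ ef / 8 := by
    rw [ha₃, div_le_div_iff₀ (by positivity) (by norm_num)]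
    nlinarith [mul_le_mul_of_nonneg_left hbH1 hef.le]
  linarith

/-- Row `hselfC` ((118), `j = θ = 0`): `bH·C₂·(εC + a₃)² ≤ εC` at `εC = a₃ = ef∕(8000(bH+1))`, `C₂ ≤ 720∕ef`. [cite: Balaban1985Variational, (118) p.295] -/
theorem row_hselfC {ef C₂ bH a₃ : ℝ} (hef : 0 < ef) (hbH : 0 < bH) (hC₂ : C₂ ≤ 720 / ef)
    (ha₃ : a₃ = ef / (8000 * (bH + 1))) : bH * C₂ * (a₃ + a₃) ^ 2 ≤ a₃ := by
  have hbH1 : 0 < bH + 1 := by linarith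
  have ha₃0 : 0 < a₃ := by rw [ha₃]; positivity
  have h1 : bH * C₂ * (a₃ + a₃) ^ 2 ≤ bH * (720 / ef) * (a₃ + a₃) ^ 2 := by gcongr
  have h2 : bH * (720 / ef) * (a₃ + a₃) ^ 2 = (2880 * bH * a₃ / ef) * a₃ := by field_simp; ring
  have h3 : 2880 * bH * a₃ / ef ≤ 1 := by
    rw [div_le_one hef, ha₃]
    rw [show 2880 * bH * (ef / (8000 * (bH + 1))) = (2880 * bH / (8000 * (bH + 1))) * ef by field_simp]
    have : 2880 * bH / (8000 * (bH + 1)) ≤ 1 := by rw [div_le_one (by positivity)]; nlinarith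
    nlinarith
  calc bH * C₂ * (a₃ + a₃) ^ 2 ≤ (2880 * bH * a₃ / ef) * a₃ := h1.trans h2.le
    _ ≤ 1 * a₃ := by gcongr
    _ = a₃ := one_mul _

/-- Row `hcontrC` ((121)₂): `4·bH·C₂·(εC + a₃) < 1` at `εC = a₃ = ef∕(8000(bH+1))`, `C₂ ≤ 720∕ef`. [cite: Balaban1985Variational, (121) p.295] -/
theorem row_hcontrC {ef C₂ bH a₃ : ℝ} (hef : 0 < ef) (hbH : 0 < bH) (hC₂ : C₂ ≤ 720 / ef)
    (ha₃ : a₃ = ef / (8000 * (bH + 1))) : 4 * bH * C₂ * (a₃ + a₃) < 1 := by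
  have hbH1 : 0 < bH + 1 := by linarith
  have ha₃0 : 0 < a₃ := by rw [ha₃]; positivity
  calc 4 * bH * C₂ * (a₃ + a₃) ≤ 4 * bH * (720 / ef) * (a₃ + a₃) := by gcongr
    _ = 5760 * bH / (8000 * (bH + 1)) := by rw [ha₃]; field_simp; ring
    _ < 1 := by rw [div_lt_one (by positivity)]; nlinarith

/-- Row `hMdoor` — MONOTONICITY of the (136)-door constant: with `C₂(α) ≤ 720∕ef`, `α ≤ α₀` and all letters nonnegative, the displayed LHS at `α` is below the same polynomial at `(720∕ef, α₀)`.
[cite: Balaban1985Variational, (136)–(140) pp.298–299] -/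
theorem row_hMdoor {ef C₂ C₄ B₀ α α₀ cC c137 kTJ k349 c137π k139π : ℝ} (hef : 0 < ef) (hB₀ : 0 < B₀) (hα0 : 0 ≤ α) (hα : α ≤ α₀)
    (hC₂0 : 0 ≤ C₂) (hC₂ : C₂ ≤ 720 / ef) (hk349 : 0 ≤ k349) (hc137π : 0 ≤ c137π) (hk139π : 0 ≤ k139π) :
    11 * B₀ + 4 * B₀ * C₂ * (11 * B₀) ^ 2 * α + ((1 + 25 * C₄ * B₀ ^ 2) + cC * (1 + 25 * C₄ * B₀ ^ 2) + c137 * 2 + kTJ * (10 * B₀) / 2 + 14 * (10 * B₀)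
      + k349 * (10 * B₀) / 2 + 2 * (10 * B₀)) + 100 * (c137π + k139π * B₀ + k349 * B₀ + (28 + 4) * α * B₀) * C₂ * B₀ ^ 2 * α
    ≤ 11 * B₀ + 4 * B₀ * (720 / ef) * (11 * B₀) ^ 2 * α₀ + ((1 + 25 * C₄ * B₀ ^ 2) + cC * (1 + 25 * C₄ * B₀ ^ 2) + c137 * 2 + kTJ * (10 * B₀) / 2 + 14 * (10 * B₀)
      + k349 * (10 * B₀) / 2 + 2 * (10 * B₀)) + 100 * (c137π + k139π * B₀ + k349 * B₀ + (28 + 4) * α₀ * B₀) * (720 / ef) * B₀ ^ 2 * α₀ := by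
  have hα₀ : 0 ≤ α₀ := hα0.trans hα
  gcongr

/-! ### §1b Row lemmas for the PROP4-W80 door's numerals `hR16 hC4` (✓p683940, engine lit ✓`quadAnalytic_W80_composite`) -/

/-- The contraction numeral behind `ℓ = (1 − 4bH·C₂·(εC + a₃))⁻¹`: at `εC = a₃ = ef∕(8000(bH+1))`, `C₂ ≤ 720∕ef`, one has `4bH·C₂·(εC + a₃) ≤ 18∕25`.
[cite: Balaban1985Variational, (121) p.295] -/
theorem contr_le {ef C₂ bH a₃ : ℝ} (hef : 0 < ef) (hbH : 0 < bH) (hC₂ : C₂ ≤ 720 / ef)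
    (ha₃ : a₃ = ef / (8000 * (bH + 1))) : 4 * bH * C₂ * (a₃ + a₃) ≤ 18 / 25 := by
  have hbH1 : 0 < bH + 1 := by linarith
  have ha₃0 : 0 < a₃ := by rw [ha₃]; positivity
  calc 4 * bH * C₂ * (a₃ + a₃) ≤ 4 * bH * (720 / ef) * (a₃ + a₃) := by gcongr
    _ = 5760 * bH / (8000 * (bH + 1)) := by rw [ha₃]; field_simp; ring
    _ ≤ 18 / 25 := by rw [div_le_div_iff₀ (by positivity) (by norm_num)]; nlinarith

/-- Hence lit's `ℓ = (1 − 4bH·C₂·(εC + a₃))⁻¹ ≤ 25∕7` and `ℓ ≥ 0`. [cite: Balaban1985Variational, (121) p.295] -/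
theorem ell_le {x : ℝ} (hx : x ≤ 18 / 25) : 1 / (1 - x) ≤ 25 / 7 ∧ 0 ≤ 1 / (1 - x) := by
  have h1 : 0 < 1 - x := by linarith
  refine ⟨?_, by positivity⟩
  rw [div_le_div_iff₀ h1 (by norm_num)]
  linarith

/-- PROP4-W80's row `hR16` (✓p683940: lit's `hR'V` at `R′ := a₃`, `RV = 1∕16`): `a₃ ≤ (1 − 4bH·C₂·(εC + a₃))·(1∕16)` at the census witnesses (`a₃ ≤ ef ≤ (356·10⁷)⁻¹ ≤ 7∕400`).
[cite: Balaban1985Variational, Prop. 4 (98) p.293] -/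
theorem row_hR16 {ef C₂ bH a₃ Lr : ℝ} (hLr : 1 ≤ Lr) (hef : ef = 1 / (356 * 10 ^ 7 * Lr ^ 3)) (hbH : 0 < bH) (hC₂ : C₂ ≤ 720 / ef)
    (ha₃ : a₃ = ef / (8000 * (bH + 1))) : a₃ ≤ (1 - 4 * bH * C₂ * (a₃ + a₃)) * (1 / 16) := by
  have hL0 : 0 < Lr := by linarith
  have hef0 : 0 < ef := by rw [hef]; positivity
  have hx := contr_le hef0 hbH hC₂ ha₃
  have hbH1 : (1 : ℝ) ≤ bH + 1 := by linarith
  have h1 : a₃ ≤ ef := by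
    rw [ha₃, div_le_iff₀ (by positivity)]; nlinarith
  have h2 : ef ≤ 7 / 400 := by
    rw [hef, div_le_div_iff₀ (by positivity) (by norm_num)]
    nlinarith [pow_pos hL0 3, one_le_pow₀ (n := 3) hLr]
  nlinarith

/-- PROP4-W80's row `hC4` (✓p683940, the constant of lit ✓`quadAnalytic_W80_composite` with `‖J‖ ≤ α`, `‖ρ₂‖ ≤ Mρ`, `‖tr‖ ≤ Mτ`) is MONOTONE in `(α, C₂, ℓ)`: its LHS at the census witnesses is
below the same polynomial at the bars `α ↦ 1`, `C₂ ↦ 720∕ef`, `ℓ ↦ 25∕7`. [cite: Balaban1985Variational, Prop. 4 (97)–(98) pp.292–293] -/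
theorem row_hC4 {ef C₂ bH a₃ α Mρ Mτ θ₃ θE N₁ CV : ℝ} (θE' : ℝ) (hef : 0 < ef) (hbH : 0 < bH) (hC₂ : C₂ ≤ 720 / ef)
    (ha₃ : a₃ = ef / (8000 * (bH + 1))) (hα1 : α ≤ 1) (hMρ : 0 ≤ Mρ) (hMτ : 0 ≤ Mτ) (hθ₃ : 0 ≤ θ₃) (hθE : 0 ≤ θE)
    (hN₁ : 0 ≤ N₁) (hCV : 0 ≤ CV) :
    Mρ * Mτ * θ₃ * α + (N₁ * C₂ * (1 / (1 - 4 * bH * C₂ * (a₃ + a₃))) ^ 2 + Mρ * Mτ * θE')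
        + Mρ * Mτ * θE * (N₁ * C₂ * (1 / (1 - 4 * bH * C₂ * (a₃ + a₃))) ^ 2) * a₃ + Mρ * Mτ * (1 + θE * a₃) * CV * (1 / (1 - 4 * bH * C₂ * (a₃ + a₃))) ^ 2
      ≤ Mρ * Mτ * θ₃ * 1 + (N₁ * (720 / ef) * (25 / 7) ^ 2 + Mρ * Mτ * θE')
        + Mρ * Mτ * θE * (N₁ * (720 / ef) * (25 / 7) ^ 2) * a₃ + Mρ * Mτ * (1 + θE * a₃) * CV * (25 / 7) ^ 2 := by
  have hbH1 : 0 < bH + 1 := by linarith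
  have ha₃0 : 0 ≤ a₃ := by rw [ha₃]; positivity
  obtain ⟨hℓ, hℓ0⟩ := ell_le (contr_le hef hbH hC₂ ha₃)
  gcongr

/-! ## §2 ★★ The family certificate: S13ᴰ's twelve windows + RC-OF-ROWS' five rows are jointly inhabited -/

/-- ★★ **«NUMERICS-CENSUS», KERNEL FORM — the seventeen L-only numeric rows of the EX display S13ᴰ (✓p682315) and of RC-OF-ROWS (✓p682625) ARE JOINTLY INHABITED**, for every block size and all
positive letters `B₀ C₄ bH` (`B₀ ≤ bH`) and nonnegative N06 letters `cC c137 kTJ k349 c137π k139π`: there are `ef α a₃ r ε′ εC M : ℕ → ℝ`, positive on `1 < L`, with `hWQ hWe hWε hMe hw137 hq47 hR6 hrε2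
hrα hr4 hr16 hMdoor hεC hdomC hselfC hcontrC` in the display's binder shapes VERBATIM.  Explicit witnesses (memo `NUMERICS-CENSUS-px14g3.md` §2): `ef := (356·10⁷·L³)⁻¹`, `a₃ := εC := ef∕(8000(bH+1))`,
`r := min(a₃∕4, (16B₀C₄)⁻¹)`, `M :=` the door polynomial at `(720∕ef, α₀ := ef∕(2700L))`, `α := ½·min(min(α₀, ef∕M), min(r∕(2B₀), (13·10¹⁴L³)⁻¹))`, `ε′ := 2(r + 2B₀α)`.
[cite: Balaban1985Variational, Thm 1 p.279, (77) p.290, Prop. 4 (98) p.293, (118)–(121) p.295, (136)–(140) pp.298–299] -/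
theorem numericWindows_inhabited_family
    (B₀ C₄ bH cC c137 kTJ k349 c137π k139π : ℕ → ℝ) (hB₀ : ∀ L, 1 < L → 0 < B₀ L) (hC₄ : ∀ L, 1 < L → 0 < C₄ L) (hbH : ∀ L : ℕ, 1 < L → B₀ L ≤ bH L)
    (hk : ∀ L : ℕ, 1 < L → 0 ≤ cC L ∧ 0 ≤ c137 L ∧ 0 ≤ kTJ L ∧ 0 ≤ k349 L ∧ 0 ≤ c137π L ∧ 0 ≤ k139π L) :
    ∃ ef α a₃ r ε' εC M : ℕ → ℝ,
      (∀ L, 1 < L → 0 < ef L) ∧ (∀ L, 1 < L → 0 < α L) ∧ (∀ L, 1 < L → 0 < a₃ L) ∧ (∀ L, 1 < L → 0 < r L) ∧ (∀ L, 1 < L → 0 < M L) ∧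
      -- hWQ hWe hWε hMe hw137
      (∀ L : ℕ, 1 < L → 13 * 10 ^ 14 * (L : ℝ) ^ 3 * α L ≤ 1) ∧ (∀ L : ℕ, 1 < L → 10 ^ 9 * (L : ℝ) ^ 2 * ef L ≤ 1) ∧ (∀ L : ℕ, 1 < L → 10 ^ 12 * (L : ℝ) ^ 3 * α L ≤ 1) ∧
      (∀ L, 1 < L → M L * α L < ef L) ∧ (∀ L : ℕ, 1 < L → 10 ^ 7 * (L : ℝ) ^ 3 * (178 * (α L + ef L)) ≤ 1) ∧
      -- hq47 hR6 hrε2 (at ε′)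
      (∀ L : ℕ, 1 < L → 9 * (40 * (2 * (3 * (2 * ef L + 2700 * (L : ℝ) * α L))) / ef L ^ 2) * B₀ L * ε' L < 1) ∧ (∀ L : ℕ, 1 < L → 6 * ε' L ≤ ef L) ∧
      (∀ L : ℕ, 1 < L → 2 * (r L + 2 * B₀ L * α L) ≤ ε' L) ∧
      -- hrα hr4 hr16
      (∀ L : ℕ, 1 < L → 2 * B₀ L * α L ≤ r L) ∧ (∀ L : ℕ, 1 < L → 4 * r L ≤ a₃ L) ∧ (∀ L : ℕ, 1 < L → 16 * B₀ L * C₄ L * r L ≤ 1) ∧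
      -- hMdoor
      (∀ L : ℕ, 1 < L → 11 * B₀ L + 4 * B₀ L * (40 * (2 * (3 * (2 * ef L + 2700 * (L : ℝ) * α L))) / ef L ^ 2) * (11 * B₀ L) ^ 2 * α L + ((1 + 25 * C₄ L * B₀ L ^ 2) + cC L * (1 + 25 * C₄ L * B₀ L ^ 2) + c137 L * 2 + kTJ L * (10 * B₀ L) / 2 + 14 * (10 * B₀ L) + k349 L * (10 * B₀ L) / 2 + 2 * (10 * B₀ L)) + 100 * (c137π L + k139π L * B₀ L + k349 L * B₀ L + (28 + 4) * α L * B₀ L) * (40 * (2 * (3 * (2 * ef L + 2700 * (L : ℝ) * α L))) / ef L ^ 2) * B₀ L ^ 2 * α L ≤ M L) ∧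
      -- RC-OF-ROWS: hεC hdomC hselfC hcontrC (`hbH` is the hypothesis)
      (∀ L : ℕ, 1 < L → 0 ≤ εC L) ∧ (∀ L : ℕ, 1 < L → 2 * (εC L + a₃ L) ≤ ef L / 2) ∧
      (∀ L : ℕ, 1 < L → bH L * (40 * (2 * (3 * (2 * ef L + 2700 * (L : ℝ) * α L))) / ef L ^ 2) * (εC L + a₃ L) ^ 2 ≤ εC L) ∧
      (∀ L : ℕ, 1 < L → 4 * bH L * (40 * (2 * (3 * (2 * ef L + 2700 * (L : ℝ) * α L))) / ef L ^ 2) * (εC L + a₃ L) < 1) := by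
  classical
  -- the witnesses
  let ef : ℕ → ℝ := fun L => 1 / (356 * 10 ^ 7 * (L : ℝ) ^ 3)
  let α₀ : ℕ → ℝ := fun L => ef L / (2700 * (L : ℝ))
  let a₃ : ℕ → ℝ := fun L => ef L / (8000 * (bH L + 1))
  let r : ℕ → ℝ := fun L => min (a₃ L / 4) (1 / (16 * B₀ L * C₄ L))
  let M : ℕ → ℝ := fun L => 11 * B₀ L + 4 * B₀ L * (720 / ef L) * (11 * B₀ L) ^ 2 * α₀ L + ((1 + 25 * C₄ L * B₀ L ^ 2) + cC L * (1 + 25 * C₄ L * B₀ L ^ 2)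
      + c137 L * 2 + kTJ L * (10 * B₀ L) / 2 + 14 * (10 * B₀ L) + k349 L * (10 * B₀ L) / 2 + 2 * (10 * B₀ L))
      + 100 * (c137π L + k139π L * B₀ L + k349 L * B₀ L + (28 + 4) * α₀ L * B₀ L) * (720 / ef L) * B₀ L ^ 2 * α₀ L
  let α : ℕ → ℝ := fun L => (1 / 2) * min (min (α₀ L) (ef L / M L)) (min (r L / (2 * B₀ L)) (1 / (13 * 10 ^ 14 * (L : ℝ) ^ 3)))
  let ε' : ℕ → ℝ := fun L => 2 * (r L + 2 * B₀ L * α L)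
  -- positivity of the witnesses and the elementary comparisons, at each `L > 1`
  have hLr : ∀ L : ℕ, 1 < L → (1 : ℝ) ≤ (L : ℝ) := fun L hL => by exact_mod_cast hL.le
  have hef : ∀ L : ℕ, 1 < L → 0 < ef L := fun L hL => by
    have := hLr L hL; simp only [ef]; positivity
  have hbH1 : ∀ L : ℕ, 1 < L → 0 < bH L + 1 := fun L hL => by linarith [hB₀ L hL, hbH L hL]
  have hbH0 : ∀ L : ℕ, 1 < L → 0 < bH L := fun L hL => lt_of_lt_of_le (hB₀ L hL) (hbH L hL)
  have ha₃ : ∀ L : ℕ, 1 < L → 0 < a₃ L := fun L hL => by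
    have := hef L hL; have := hbH1 L hL; simp only [a₃]; positivity
  have hα₀ : ∀ L : ℕ, 1 < L → 0 < α₀ L := fun L hL => by
    have := hef L hL; have := hLr L hL; simp only [α₀]; positivity
  have hr : ∀ L : ℕ, 1 < L → 0 < r L := fun L hL => by
    have := ha₃ L hL; have := hB₀ L hL; have := hC₄ L hL
    simp only [r]; exact lt_min (by positivity) (by positivity)
  have hM : ∀ L : ℕ, 1 < L → 0 < M L := fun L hL => by
    obtain ⟨h1, h2, h3, h4, h5, h6⟩ := hk L hL
    have := hef L hL; have := hB₀ L hL; have := hC₄ L hL; have := hα₀ L hL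
    simp only [M]; positivity
  have hα : ∀ L : ℕ, 1 < L → 0 < α L := fun L hL => by
    have := hef L hL; have := hM L hL; have := hr L hL; have := hB₀ L hL; have := hα₀ L hL; have := hLr L hL
    simp only [α]
    refine mul_pos (by norm_num) (lt_min (lt_min ‹0 < α₀ L› (by positivity)) (lt_min (by positivity) (by positivity)))
  -- the four caps on `α`
  have hα_le₀ : ∀ L : ℕ, 1 < L → α L ≤ α₀ L / 2 := fun L hL => by
    simp only [α]
    have : min (min (α₀ L) (ef L / M L)) (min (r L / (2 * B₀ L)) (1 / (13 * 10 ^ 14 * (L : ℝ) ^ 3))) ≤ α₀ L := (min_le_left _ _).trans (min_le_left _ _)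
    linarith
  have hα_leM : ∀ L : ℕ, 1 < L → α L ≤ (ef L / M L) / 2 := fun L hL => by
    simp only [α]
    have : min (min (α₀ L) (ef L / M L)) (min (r L / (2 * B₀ L)) (1 / (13 * 10 ^ 14 * (L : ℝ) ^ 3))) ≤ ef L / M L := (min_le_left _ _).trans (min_le_right _ _)
    linarith
  have hα_ler : ∀ L : ℕ, 1 < L → α L ≤ (r L / (2 * B₀ L)) / 2 := fun L hL => by
    simp only [α]
    have : min (min (α₀ L) (ef L / M L)) (min (r L / (2 * B₀ L)) (1 / (13 * 10 ^ 14 * (L : ℝ) ^ 3))) ≤ r L / (2 * B₀ L) := (min_le_right _ _).trans (min_le_left _ _)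
    linarith
  have hα_leQ : ∀ L : ℕ, 1 < L → α L ≤ (1 / (13 * 10 ^ 14 * (L : ℝ) ^ 3)) / 2 := fun L hL => by
    simp only [α]
    have : min (min (α₀ L) (ef L / M L)) (min (r L / (2 * B₀ L)) (1 / (13 * 10 ^ 14 * (L : ℝ) ^ 3))) ≤ 1 / (13 * 10 ^ 14 * (L : ℝ) ^ 3) :=
      (min_le_right _ _).trans (min_le_right _ _)
    linarith
  -- derived comparisons
  have hα_le_α₀ : ∀ L : ℕ, 1 < L → α L ≤ α₀ L := fun L hL => by linarith [hα_le₀ L hL, hα₀ L hL]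
  have h2700 : ∀ L : ℕ, 1 < L → 2700 * (L : ℝ) * α L ≤ ef L := fun L hL => by
    have hL0 : (0 : ℝ) < L := by linarith [hLr L hL]
    have h := hα_le_α₀ L hL
    simp only [α₀] at h
    rw [le_div_iff₀ (by positivity)] at h
    linarith
  have h2700₀ : ∀ L : ℕ, 1 < L → 2700 * (L : ℝ) * α₀ L ≤ ef L := fun L hL => by
    have hL0 : (0 : ℝ) < L := by linarith [hLr L hL]
    simp only [α₀]; rw [mul_div_assoc']; rw [div_le_iff₀ (by positivity)]; nlinarith [hef L hL]
  have hC₂ : ∀ L : ℕ, 1 < L → 40 * (2 * (3 * (2 * ef L + 2700 * (L : ℝ) * α L))) / ef L ^ 2 ≤ 720 / ef L := fun L hL =>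
    C₂_le (hef L hL) (h2700 L hL)
  have hC₂0 : ∀ L : ℕ, 1 < L → 0 ≤ 40 * (2 * (3 * (2 * ef L + 2700 * (L : ℝ) * α L))) / ef L ^ 2 := fun L hL =>
    C₂_nonneg (hef L hL) (by linarith [hLr L hL]) (hα L hL).le
  have hα_le_ef : ∀ L : ℕ, 1 < L → α L ≤ ef L := fun L hL => by
    have h := h2700 L hL
    have hL1 := hLr L hL
    nlinarith [hα L hL]
  have hr_le_a₃ : ∀ L : ℕ, 1 < L → r L ≤ a₃ L / 4 := fun L hL => min_le_left _ _
  have hr_le_C₄ : ∀ L : ℕ, 1 < L → r L ≤ 1 / (16 * B₀ L * C₄ L) := fun L hL => min_le_right _ _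
  have h2B₀α : ∀ L : ℕ, 1 < L → 2 * B₀ L * α L ≤ r L / 2 := fun L hL => by
    have h := hα_ler L hL
    have hB := hB₀ L hL
    rw [div_div, le_div_iff₀ (by positivity)] at h
    linarith
  have hε'_le : ∀ L : ℕ, 1 < L → ε' L ≤ a₃ L := fun L hL => by
    simp only [ε']; linarith [h2B₀α L hL, hr_le_a₃ L hL, (ha₃ L hL).le]
  have hε'0 : ∀ L : ℕ, 1 < L → 0 ≤ ε' L := fun L hL => by
    have := hr L hL; have := hB₀ L hL; have := hα L hL; simp only [ε']; positivity
  refine ⟨ef, α, a₃, r, ε', a₃, M, hef, hα, ha₃, hr, hM, ?_, ?_, ?_, ?_, ?_, ?_, ?_, ?_, ?_, ?_, ?_, ?_, ?_, ?_, ?_, ?_⟩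
  -- hWQ
  · intro L hL
    have h := hα_leQ L hL
    have hL0 : (0 : ℝ) < L := by linarith [hLr L hL]
    rw [div_div, le_div_iff₀ (by positivity)] at h
    linarith
  -- hWe
  · intro L hL
    exact row_hWe (hLr L hL)
  -- hWε
  · intro L hL
    have h := hα_leQ L hL
    have hL0 : (0 : ℝ) < L := by linarith [hLr L hL]
    rw [div_div, le_div_iff₀ (by positivity)] at h
    nlinarith [hα L hL, pow_pos hL0 3]
  -- hMe
  · intro L hL
    have h := hα_leM L hL
    have hM' := hM L hL
    rw [div_div, le_div_iff₀ (by positivity)] at h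
    nlinarith [hef L hL]
  -- hw137
  · intro L hL
    have hL0 : (0 : ℝ) < L := by linarith [hLr L hL]
    exact row_hw137 hL0 (hα_le_ef L hL)
  -- hq47
  · intro L hL
    exact row_hq47 (hef L hL) (hB₀ L hL) (hbH L hL) (hC₂ L hL) (hε'0 L hL) (hε'_le L hL) rfl
  -- hR6
  · intro L hL
    exact row_hR6 (hef L hL) (hbH0 L hL) (hε'_le L hL) rfl
  -- hrε2
  · intro L hL
    exact le_rfl
  -- hrα
  · intro L hL
    linarith [h2B₀α L hL, hr L hL]
  -- hr4
  · intro L hL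
    linarith [hr_le_a₃ L hL]
  -- hr16
  · intro L hL
    have h := hr_le_C₄ L hL
    have := hB₀ L hL; have := hC₄ L hL
    rw [le_div_iff₀ (by positivity)] at h
    linarith
  -- hMdoor
  · intro L hL
    obtain ⟨-, -, -, h4, h5, h6⟩ := hk L hL
    exact row_hMdoor (hef L hL) (hB₀ L hL) (hα L hL).le (hα_le_α₀ L hL) (hC₂0 L hL) (hC₂ L hL) h4 h5 h6
  -- hεC
  · intro L hL
    exact (ha₃ L hL).le
  -- hdomC
  · intro L hL
    exact row_hdomC (hef L hL) (hbH0 L hL) rfl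
  -- hselfC
  · intro L hL
    exact row_hselfC (hef L hL) (hbH0 L hL) (hC₂ L hL) rfl
  -- hcontrC
  · intro L hL
    exact row_hcontrC (hef L hL) (hbH0 L hL) (hC₂ L hL) rfl

end Summit.QuantumFields.YangMills.Theorems.Prop7NumericWindowsInhabited

end
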